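import Mathlib.GroupTheory.Perm.Centralizer
import Literature.Combinatorics.Sahi2008.CycleForm
import HarnessLib

/-!
# Lieb–Sahi (2022), Proposition 3.4: the partial sum of `E_n` over the permutations containing a
# FIXED CYCLE, and the expansion of `E_n` along the cycles through a fixed index (p. 8)

Topic `Literature/Combinatorics/Sahi2008`; companion of `CycleForm.lean`, which formalises Lieb–Sahi's
Definition 3.1 `E_n = Σ_{σ ∈ S_n} (−1)^{C_σ − 1} E_σ` (`sahiECycle`, with the cycles of `σ` as the finite sets
`CycleForm.orbit σ i`, `CycleForm.orbits σ`, `CycleForm.cycleE μ f σ = Π_{cycles c} E(Π_{i∈c} f^i)`) and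
proves it equal to the tree's `sahiE` [LiebSahi2021, Prop. 3.3].  This file adds the next printed item of
§3.2, Proposition 3.4, and the decomposition of `E_n` it is used for on p. 8 (proof of Theorem 3.5).

## Source (corpus `paper:arxiv-2107.09838`, p. 7–8 = J. Math. Phys. **63** (2022) 043301, §3.2–3.3), verbatim

> "We next establish a useful formula for the partial sum `P_c` of `E_n` over the set of permutations
> containing a fixed cycle `c`.
> **PROPOSITION 3.4.** Let `S^c` denote the set of permutations `σ ∈ S_n` that contain a fixed cycle
> `c = (i_1,…,i_p)` and let `J_c = {j_1, j_2, …} = {1,…,n} ∖ {i_1,…,i_p}`, then we have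
> `P_c := Σ_{σ ∈ S^c} (−1)^{C_σ−1} E_σ(f^1,…,f^n) = −E(f^{i_1}⋯f^{i_p}) E_{n−p}(f^{j_1}, f^{j_2}, …)` if `p < n`,
> `= E(f^1⋯f^n)` if `p = n`.
> *Proof:* The set `S^c` consists of a single permutation if `p = n`.  Otherwise it consists of permutations
> of the form `σ = c · τ` where `τ` is a permutation of `J^c`.  Evidently the number of cycles in `σ` and `τ`
> are related by `C_τ = C_σ − 1`.  Thus in this case we have
> `(−1)^{C_σ−1} E_σ(f^1⋯f^n) = −E(f^{i_1}⋯f^{i_p}) (−1)^{C_τ−1} E_τ(f^{j_1}, f^{j_2}, …)`.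
> Now the result follows by summing over `τ`."
> (p. 8, proof of Thm. 3.5:) "We now fix an index `i > 1` and let `C(i)` denote all set of all cycles containing
> `i` then we have `E_n(f^1,…,f^n) = Σ_{c ∈ C(i)} P_c` where `P_c` is as in Proposition 3.4."

## What is formalised (everything PROVED; no named facts; axioms standard)

* `CycleForm.cycleSum μ f` — Definition 3.1 over an ARBITRARY finite index type `κ` (the family
  `f : κ → α → ℝ`); `sahiECycle μ n f = cycleSum μ f` is `rfl`, `sahiE μ n f = cycleSum μ f` for `n ≥ 1`
  (`sahiE_eq_cycleSum`), and `cycleSum` is invariant under re-indexing (`cycleSum_comp_equiv`).  This is what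
  makes "`E_{n−p}(f^{j_1}, f^{j_2}, …)`" — `E` of the COMPLEMENTARY family, in any enumeration — a single term:
  `cycleSum μ (fun j : {x // x ∉ B} => f j)`.
* A cycle `c = (i_1,…,i_p)` is the pair (its support `B = {i_1,…,i_p}`, a cyclic permutation `cB` of `B`:
  `cB ∈ fullCycles B`, i.e. `∀ a b, SameCycle cB a b`); "`σ` contains the cycle `c`" is "`σ` agrees with `cB`
  on `B`" (`permsContaining B cB`), and Lieb–Sahi's "`σ = c · τ`, `τ` a permutation of `J_c`" is Mathlib's
  `Equiv.Perm.subtypeCongr cB τ` (`glue B cB τ`; `permsContaining_eq_image`).  The bridge from Mathlib's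
  `Equiv.Perm.IsCycleOn c ↑B` for an ambient `c : Perm κ` is `restrictCycle` / `mem_permsContaining_restrict`.
  The number of cycles with support `B` is `(|B| − 1)!` (`card_fullCycles`, from Mathlib's
  `Equiv.Perm.card_of_cycleType_singleton`).
* `C_σ = C_τ + 1` and `E_σ = E(Π_{i∈B} f^i)·E_τ` for `σ = glue B cB τ`: `card_orbits_glue`, `cycleE_glue`.
* **Proposition 3.4**: `partialSum_eq` (`P_c = E(Π_{i∈B} f^i) · coRest μ f B` with the complementary factor
  `coRest μ f B = Σ_τ (−1)^{C_τ} E_τ`), and its two printed cases `partialSum_eq_of_ne_univ` (`p < n`: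
  `P_c = −E(Π_B f)·cycleSum μ (f|_{Bᶜ})`) and `partialSum_univ` (`p = n`: `P_c = E(f^1⋯f^n)`); verbatim on
  `Fin n` with an arbitrary enumeration `j : Fin m ≃ J_c` of the complement and the tree's `sahiE`:
  **`liebSahi_prop34`** and `liebSahi_prop34_top`.
* **p. 8**: `cyclesThrough i` (= `C(i)`), **`cycleSum_eq_sum_cyclesThrough`** (`E_n = Σ_{c ∈ C(i)} P_c`), and
  the evaluated BLOCK EXPANSION along the cycle through `i`:
  **`cycleSum_eq_sum_blocks`** / **`sahiE_eq_sum_blocks`**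
  `E_n(f) = Σ_{B ∋ i} (|B| − 1)! · E(Π_{j∈B} f^j) · coRest μ f B`
  (`coRest = 1` for `B` = everything, `= −E_{n−|B|}(f|_{Bᶜ})` otherwise: `coRest_univ`, `coRest_of_ne_univ`).

Motivation: crux `stmt-CriticalPhenomena-4575` (cell prim-sahi): the identity catalogues of the census
(`Summits/…/SahiAbsorbedSlots.lean`, `SahiAbsorbingFrame.lean`) expand `E_n` along blocks; this is the printed
form of that expansion.  The tree's proof of [LiebSahi2021, Thm. 3.5] (`Rectangles.lean`) went through Sahi's
Theorem 2 instead of Prop. 3.4 (documented deviation there); with this file the printed route is available too.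
-/

noncomputable section

namespace Literature.Combinatorics.Sahi2008

open Finset Function Equiv Equiv.Perm

variable {α : Type*} [Fintype α]

namespace CycleForm

/-! ### `SameCycle` with natural-number witnesses (finite types) -/

section NatWitness

variable {κ : Type*} [Finite κ]

/-- On a finite type, `SameCycle σ x y` iff `σ^k x = y` for some `k : ℕ`. [folklore] -/
private theorem sameCycle_iff_exists_pow {σ : Perm κ} {x y : κ} :
    SameCycle σ x y ↔ ∃ k : ℕ, (σ ^ k) x = y :=
  ⟨fun h => h.exists_nat_pow_eq, fun ⟨k, hk⟩ => ⟨k, by simpa using hk⟩⟩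

end NatWitness

section CycleSum

variable {κ : Type*} [Fintype κ] [DecidableEq κ]

/-! ### Definition 3.1 over an arbitrary finite index type, and re-indexing -/

/-- **`E` of a finite FAMILY `f : κ → (α → ℝ)` in cycle form**: `Σ_{σ ∈ Sym(κ)} (−1)^{C_σ − 1} E_σ(f)` —
Lieb–Sahi's Definition 3.1 with the index set `{1,…,n}` replaced by an arbitrary finite type `κ` (so that
"`E_{n−p}(f^{j_1}, f^{j_2}, …)`" for the complementary index set `J_c` of Prop. 3.4 needs no enumeration).
For `κ = Fin n` this is `sahiECycle μ n f` by `rfl`. [cite: LiebSahi2021, Def. 3.1 (p. 7)] -/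
def cycleSum (μ : α → ℝ) (f : κ → α → ℝ) : ℝ :=
  ∑ σ : Perm κ, (-1 : ℝ) ^ ((orbits σ).card - 1) * cycleE μ f σ

/-- `sahiECycle` is `cycleSum` on `Fin n`. [cite: LiebSahi2021, Def. 3.1 (p. 7)] -/
theorem sahiECycle_eq_cycleSum (μ : α → ℝ) (n : ℕ) (f : Fin n → α → ℝ) :
    sahiECycle μ n f = cycleSum μ f := rfl

/-- The tree's `E_n` is `cycleSum` on `Fin n`, `n ≥ 1`. [cite: LiebSahi2021, Def. 3.1 and Prop. 3.3 (p. 7)] -/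
theorem sahiE_eq_cycleSum (μ : α → ℝ) {n : ℕ} (hn : 1 ≤ n) (f : Fin n → α → ℝ) :
    sahiE μ n f = cycleSum μ f :=
  sahiE_eq_sahiECycle μ n hn f

variable {κ' : Type*} [Fintype κ'] [DecidableEq κ']

omit [Fintype κ] [DecidableEq κ] [Fintype κ'] [DecidableEq κ'] in
/-- Conjugation by an equivalence commutes with powers. [folklore] -/
private theorem permCongr_pow (e : κ ≃ κ') (σ : Perm κ) (k : ℕ) :
    (e.permCongr σ) ^ k = e.permCongr (σ ^ k) := by
  induction k with
  | zero =>
    ext x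
    simp [Equiv.permCongr_apply]
  | succ k ih => rw [pow_succ, ih, pow_succ, Equiv.permCongr_mul]

omit [DecidableEq κ] [DecidableEq κ'] in
/-- Conjugation by an equivalence preserves `SameCycle`. [folklore] -/
private theorem sameCycle_permCongr (e : κ ≃ κ') (σ : Perm κ) (x y : κ) :
    SameCycle (e.permCongr σ) (e x) (e y) ↔ SameCycle σ x y := by
  simp only [sameCycle_iff_exists_pow, permCongr_pow, Equiv.permCongr_apply, Equiv.symm_apply_apply,
    e.apply_eq_iff_eq]

/-- The cycle of `e x` under the conjugate `e σ e⁻¹` is the image of the cycle of `x`.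
[cite: LiebSahi2021, §3.1 eq. (13) (p. 7)] -/
theorem orbit_permCongr (e : κ ≃ κ') (σ : Perm κ) (x : κ) :
    orbit (e.permCongr σ) (e x) = (orbit σ x).map e.toEmbedding := by
  ext y'
  rw [mem_map_equiv, mem_orbit, mem_orbit, ← sameCycle_permCongr e σ x (e.symm y'), e.apply_symm_apply]

/-- The cycles of a conjugate are the images of the cycles. [cite: LiebSahi2021, §3.1 eq. (13) (p. 7)] -/
theorem orbits_permCongr (e : κ ≃ κ') (σ : Perm κ) :
    orbits (e.permCongr σ) = (orbits σ).image (Finset.map e.toEmbedding) := by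
  ext O
  simp only [orbits, mem_image, mem_univ, true_and]
  constructor
  · rintro ⟨x', rfl⟩
    exact ⟨orbit σ (e.symm x'), ⟨e.symm x', rfl⟩, by rw [← orbit_permCongr, e.apply_symm_apply]⟩
  · rintro ⟨O₀, ⟨x, rfl⟩, rfl⟩
    exact ⟨e x, orbit_permCongr e σ x⟩

/-- Conjugation preserves the number of cycles `C_σ`. [cite: LiebSahi2021, §3.1 eq. (13) (p. 7)] -/
theorem card_orbits_permCongr (e : κ ≃ κ') (σ : Perm κ) :
    (orbits (e.permCongr σ)).card = (orbits σ).card := by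
  rw [orbits_permCongr, card_image_of_injective _ (map_injective e.toEmbedding)]

/-- `E_{eσe⁻¹}(f) = E_σ(f ∘ e)` (re-indexing the family along the conjugation).
[cite: LiebSahi2021, §3.1 eq. (14) (p. 7)] -/
theorem cycleE_permCongr (μ : α → ℝ) (f : κ' → α → ℝ) (e : κ ≃ κ') (σ : Perm κ) :
    cycleE μ f (e.permCongr σ) = cycleE μ (fun j => f (e j)) σ := by
  unfold cycleE
  rw [orbits_permCongr, prod_image fun O₁ _ O₂ _ h => map_injective e.toEmbedding h]
  refine prod_congr rfl fun O _ => ?_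
  congr 1
  funext x
  rw [prod_map]
  rfl

/-- **Re-indexing invariance of Definition 3.1**: `E` of the family `f ∘ e` (indexed by `κ`) equals `E` of `f`
(indexed by `κ'`) for every bijection `e : κ ≃ κ'` — the sum over `Sym(κ')` is the sum over the conjugates.
In particular `E_{n−p}(f^{j_1}, f^{j_2}, …)` in Prop. 3.4 does not depend on the enumeration of `J_c`.
[cite: LiebSahi2021, Def. 3.1 (p. 7)] -/
theorem cycleSum_comp_equiv (μ : α → ℝ) (e : κ ≃ κ') (f : κ' → α → ℝ) :
    cycleSum μ (fun j => f (e j)) = cycleSum μ f := by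
  unfold cycleSum
  exact Fintype.sum_equiv e.permCongr _ _ fun σ => by rw [card_orbits_permCongr, cycleE_permCongr]

/-! ### "`σ = c · τ` where `τ` is a permutation of `J_c`": gluing a permutation of `B` with one of `Bᶜ` -/

section Glue

variable (B : Finset κ)

omit [Fintype κ] in
/-- The permutation of `κ` that is `cB` on `B` and `τ` off `B` — Lieb–Sahi's "`σ = c · τ`" (Mathlib's
`Equiv.Perm.subtypeCongr`). [cite: LiebSahi2021, Prop. 3.4, proof (p. 7)] -/
def glue (cB : Perm {x // x ∈ B}) (τ : Perm {x // x ∉ B}) : Perm κ :=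
  cB.subtypeCongr τ

variable {B}

omit [Fintype κ] in
/-- On `B` the glued permutation is `cB`. [cite: LiebSahi2021, Prop. 3.4, proof (p. 7)] -/
@[simp] theorem glue_apply_mem (cB : Perm {x // x ∈ B}) (τ : Perm {x // x ∉ B}) {x : κ} (hx : x ∈ B) :
    glue B cB τ x = cB ⟨x, hx⟩ :=
  Perm.subtypeCongr.left_apply cB τ hx

omit [Fintype κ] in
/-- Off `B` the glued permutation is `τ`. [cite: LiebSahi2021, Prop. 3.4, proof (p. 7)] -/
@[simp] theorem glue_apply_not_mem (cB : Perm {x // x ∈ B}) (τ : Perm {x // x ∉ B}) {x : κ} (hx : x ∉ B) :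
    glue B cB τ x = τ ⟨x, hx⟩ :=
  Perm.subtypeCongr.right_apply cB τ hx

omit [Fintype κ] in
/-- `glue` is Mathlib's monoid hom `subtypeCongrHom`. [folklore] -/
private theorem glue_eq_subtypeCongrHom (cB : Perm {x // x ∈ B}) (τ : Perm {x // x ∉ B}) :
    glue B cB τ = subtypeCongrHom (fun x => x ∈ B) (cB, τ) := rfl

omit [Fintype κ] in
/-- Powers of a glued permutation are glued powers. [folklore] -/
private theorem glue_pow (cB : Perm {x // x ∈ B}) (τ : Perm {x // x ∉ B}) (k : ℕ) :
    glue B cB τ ^ k = glue B (cB ^ k) (τ ^ k) := by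
  rw [glue_eq_subtypeCongrHom, glue_eq_subtypeCongrHom, ← map_pow, Prod.pow_mk]

omit [Fintype κ] in
/-- The pair `(cB, τ)` is determined by the glued permutation. [folklore] -/
private theorem glue_inj {cB cB' : Perm {x // x ∈ B}} {τ τ' : Perm {x // x ∉ B}} :
    glue B cB τ = glue B cB' τ' ↔ cB = cB' ∧ τ = τ' := by
  rw [glue_eq_subtypeCongrHom, glue_eq_subtypeCongrHom, (subtypeCongrHom_injective _).eq_iff, Prod.mk_inj]

omit [Fintype κ] in
/-- For fixed `cB`, `τ ↦ glue B cB τ` is injective ("a bijection onto `S^c`").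
[cite: LiebSahi2021, Prop. 3.4, proof (p. 7)] -/
theorem glue_injective (cB : Perm {x // x ∈ B}) : Function.Injective (glue B cB) :=
  fun _ _ h => (glue_inj.1 h).2

omit [Fintype κ] in
/-- Iterates of the glued permutation on a point of `B`. [folklore] -/
private theorem pow_glue_apply_mem (cB : Perm {x // x ∈ B}) (τ : Perm {x // x ∉ B}) {x : κ} (hx : x ∈ B) (k : ℕ) :
    (glue B cB τ ^ k) x = ((cB ^ k) ⟨x, hx⟩ : κ) := by
  rw [glue_pow, glue_apply_mem _ _ hx]

omit [Fintype κ] in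
/-- Iterates of the glued permutation on a point off `B`. [folklore] -/
private theorem pow_glue_apply_not_mem (cB : Perm {x // x ∈ B}) (τ : Perm {x // x ∉ B}) {x : κ} (hx : x ∉ B)
    (k : ℕ) : (glue B cB τ ^ k) x = ((τ ^ k) ⟨x, hx⟩ : κ) := by
  rw [glue_pow, glue_apply_not_mem _ _ hx]

/-- `SameCycle` for the glued permutation, starting in `B`: one stays in `B` and moves by `cB`. [folklore] -/
private theorem sameCycle_glue_iff_of_mem (cB : Perm {x // x ∈ B}) (τ : Perm {x // x ∉ B}) {x : κ} (hx : x ∈ B)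
    {y : κ} : SameCycle (glue B cB τ) x y ↔ ∃ hy : y ∈ B, SameCycle cB ⟨x, hx⟩ ⟨y, hy⟩ := by
  rw [sameCycle_iff_exists_pow]
  constructor
  · rintro ⟨k, rfl⟩
    rw [pow_glue_apply_mem _ _ hx]
    exact ⟨((cB ^ k) ⟨x, hx⟩).2, sameCycle_iff_exists_pow.2 ⟨k, rfl⟩⟩
  · rintro ⟨hy, h⟩
    obtain ⟨k, hk⟩ := sameCycle_iff_exists_pow.1 h
    exact ⟨k, by rw [pow_glue_apply_mem _ _ hx, hk]⟩

/-- `SameCycle` for the glued permutation, starting off `B`: one stays off `B` and moves by `τ`. [folklore] -/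
private theorem sameCycle_glue_iff_of_not_mem (cB : Perm {x // x ∈ B}) (τ : Perm {x // x ∉ B}) {x : κ} (hx : x ∉ B)
    {y : κ} : SameCycle (glue B cB τ) x y ↔ ∃ hy : y ∉ B, SameCycle τ ⟨x, hx⟩ ⟨y, hy⟩ := by
  rw [sameCycle_iff_exists_pow]
  constructor
  · rintro ⟨k, rfl⟩
    rw [pow_glue_apply_not_mem _ _ hx]
    exact ⟨((τ ^ k) ⟨x, hx⟩).2, sameCycle_iff_exists_pow.2 ⟨k, rfl⟩⟩
  · rintro ⟨hy, h⟩
    obtain ⟨k, hk⟩ := sameCycle_iff_exists_pow.1 h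
    exact ⟨k, by rw [pow_glue_apply_not_mem _ _ hx, hk]⟩

/-- If `cB` is ONE cycle on `B`, the cycle of `σ = c·τ` through any point of `B` is `B` itself.
[cite: LiebSahi2021, Prop. 3.4, proof (p. 7)] -/
theorem orbit_glue_of_mem {cB : Perm {x // x ∈ B}} (hcB : ∀ a b, SameCycle cB a b) (τ : Perm {x // x ∉ B})
    {x : κ} (hx : x ∈ B) : orbit (glue B cB τ) x = B := by
  ext y
  rw [mem_orbit, sameCycle_glue_iff_of_mem cB τ hx]
  exact ⟨fun ⟨hy, _⟩ => hy, fun hy => ⟨hy, hcB _ _⟩⟩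

/-- Off `B`, the cycles of `σ = c·τ` are the cycles of `τ`. [cite: LiebSahi2021, Prop. 3.4, proof (p. 7)] -/
theorem orbit_glue_of_not_mem (cB : Perm {x // x ∈ B}) (τ : Perm {x // x ∉ B}) {x : κ} (hx : x ∉ B) :
    orbit (glue B cB τ) x = (orbit τ ⟨x, hx⟩).map (Embedding.subtype _) := by
  ext y
  rw [mem_orbit, sameCycle_glue_iff_of_not_mem cB τ hx, mem_map]
  constructor
  · rintro ⟨hy, h⟩
    exact ⟨⟨y, hy⟩, mem_orbit.2 h, rfl⟩
  · rintro ⟨z, hz, rfl⟩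
    exact ⟨z.2, mem_orbit.1 hz⟩

/-- No cycle of `τ` (a permutation of `Bᶜ`) has underlying set `B`. [folklore] -/
private theorem not_mem_image_orbits (τ : Perm {x // x ∉ B}) :
    B ∉ (orbits τ).image (Finset.map (Embedding.subtype _)) := by
  intro h
  obtain ⟨O', hO', hO'B⟩ := mem_image.1 h
  unfold orbits at hO'
  obtain ⟨z, -, rfl⟩ := mem_image.1 hO'
  have hz : (z : κ) ∈ (orbit τ z).map (Embedding.subtype _) := mem_map.2 ⟨z, self_mem_orbit τ z, rfl⟩
  rw [hO'B] at hz
  exact z.2 hz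

/-- **The cycles of `σ = c·τ` are `B` together with the cycles of `τ`** (`cB` one cycle on the nonempty `B`).
[cite: LiebSahi2021, Prop. 3.4, proof (p. 7)] -/
theorem orbits_glue {cB : Perm {x // x ∈ B}} (hcB : ∀ a b, SameCycle cB a b) (τ : Perm {x // x ∉ B})
    (hB : B.Nonempty) :
    orbits (glue B cB τ) = insert B ((orbits τ).image (Finset.map (Embedding.subtype _))) := by
  ext O
  simp only [orbits, mem_insert, mem_image, mem_univ, true_and]
  constructor
  · rintro ⟨x, rfl⟩
    by_cases hx : x ∈ B
    · exact Or.inl (orbit_glue_of_mem hcB τ hx)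
    · exact Or.inr ⟨orbit τ ⟨x, hx⟩, ⟨⟨x, hx⟩, rfl⟩, (orbit_glue_of_not_mem cB τ hx).symm⟩
  · rintro (rfl | ⟨O', ⟨z, rfl⟩, rfl⟩)
    · obtain ⟨x, hx⟩ := hB
      exact ⟨x, orbit_glue_of_mem hcB τ hx⟩
    · exact ⟨z, orbit_glue_of_not_mem cB τ z.2⟩

/-- **`C_σ = C_τ + 1`** for `σ = c·τ` ("the number of cycles in `σ` and `τ` are related by `C_τ = C_σ − 1`").
[cite: LiebSahi2021, Prop. 3.4, proof (p. 7)] -/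
theorem card_orbits_glue {cB : Perm {x // x ∈ B}} (hcB : ∀ a b, SameCycle cB a b) (τ : Perm {x // x ∉ B})
    (hB : B.Nonempty) : (orbits (glue B cB τ)).card = (orbits τ).card + 1 := by
  rw [orbits_glue hcB τ hB, card_insert_of_notMem (not_mem_image_orbits τ),
    card_image_of_injective _ (map_injective _)]

/-- **`E_σ(f) = E(f^{i_1}⋯f^{i_p}) · E_τ(f^{j_1}, f^{j_2}, …)`** for `σ = c·τ`.
[cite: LiebSahi2021, Prop. 3.4, proof eq. (Est) (p. 7)] -/
theorem cycleE_glue (μ : α → ℝ) (f : κ → α → ℝ) {cB : Perm {x // x ∈ B}} (hcB : ∀ a b, SameCycle cB a b)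
    (τ : Perm {x // x ∉ B}) (hB : B.Nonempty) :
    cycleE μ f (glue B cB τ) =
      ex μ (fun x => ∏ i ∈ B, f i x) * cycleE μ (fun j : {x // x ∉ B} => f j) τ := by
  unfold cycleE
  rw [orbits_glue hcB τ hB, prod_insert (not_mem_image_orbits τ),
    prod_image fun O₁ _ O₂ _ h => map_injective _ h]
  congr 1
  refine prod_congr rfl fun O _ => ?_
  congr 1
  funext x
  rw [prod_map]
  rfl

/-! ### Cycles on `B`, the set `S^c`, and `P_c` -/

/-- The cyclic permutations of `B` — the cycles `c = (i_1,…,i_p)` with `{i_1,…,i_p} = B` (for `|B| = 1` the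
one-cycle `(i)`). [cite: LiebSahi2021, §3.1 eq. (13) and Prop. 3.4 (p. 7)] -/
def fullCycles (B : Finset κ) : Finset (Perm {x // x ∈ B}) :=
  univ.filter fun c => ∀ a b, SameCycle c a b

/-- **`S^c`**: "the set of permutations `σ ∈ S_n` that contain a fixed cycle `c`" — `σ` agrees with the cycle on
its support `B`. [cite: LiebSahi2021, Prop. 3.4 (p. 7)] -/
def permsContaining (B : Finset κ) (cB : Perm {x // x ∈ B}) : Finset (Perm κ) :=
  univ.filter fun σ => ∀ x : {x // x ∈ B}, σ x = cB x

/-- **`P_c := Σ_{σ ∈ S^c} (−1)^{C_σ − 1} E_σ(f^1,…,f^n)`**, the partial sum of Definition 3.1 over `S^c`.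
[cite: LiebSahi2021, Prop. 3.4 (p. 7)] -/
def partialSum (μ : α → ℝ) (f : κ → α → ℝ) (B : Finset κ) (cB : Perm {x // x ∈ B}) : ℝ :=
  ∑ σ ∈ permsContaining B cB, (-1 : ℝ) ^ ((orbits σ).card - 1) * cycleE μ f σ

/-- The complementary factor `Σ_{τ ∈ Sym(Bᶜ)} (−1)^{C_τ} E_τ(f|_{Bᶜ})`: equal to `1` when `B` is everything and to
`−E_{n−p}(f^{j_1}, f^{j_2}, …)` otherwise (`coRest_univ`, `coRest_of_ne_univ`) — the two cases of Prop. 3.4 in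
one symbol. [cite: LiebSahi2021, Prop. 3.4 (p. 7)] -/
def coRest (μ : α → ℝ) (f : κ → α → ℝ) (B : Finset κ) : ℝ :=
  ∑ τ : Perm {x // x ∉ B}, (-1 : ℝ) ^ (orbits τ).card * cycleE μ (fun j : {x // x ∉ B} => f j) τ

/-- Membership in `fullCycles`. [cite: LiebSahi2021, §3.1 eq. (13) (p. 7)] -/
theorem mem_fullCycles {c : Perm {x // x ∈ B}} : c ∈ fullCycles B ↔ ∀ a b, SameCycle c a b := by
  simp [fullCycles]

/-- Membership in `S^c`. [cite: LiebSahi2021, Prop. 3.4 (p. 7)] -/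
theorem mem_permsContaining {cB : Perm {x // x ∈ B}} {σ : Perm κ} :
    σ ∈ permsContaining B cB ↔ ∀ x : {x // x ∈ B}, σ x = cB x := by
  simp [permsContaining]

omit [Fintype κ] [DecidableEq κ] in
/-- The restriction to `B` of an ambient permutation that is a cycle on `B` (Mathlib's `IsCycleOn`).
[cite: LiebSahi2021, §3.1 eq. (13) (p. 7)] -/
def restrictCycle (c : Perm κ) (hc : c.IsCycleOn (B : Set κ)) : Perm {x // x ∈ B} :=
  c.subtypePerm fun _ => hc.apply_mem_iff

omit [Fintype κ] [DecidableEq κ] in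
/-- Values of the restriction. [folklore] -/
@[simp] private theorem restrictCycle_apply (c : Perm κ) (hc : c.IsCycleOn (B : Set κ)) (x : {x // x ∈ B}) :
    (restrictCycle c hc x : κ) = c x := rfl

/-- The restriction of a cycle on `B` is a cyclic permutation of `B`. [cite: LiebSahi2021, §3.1 eq. (13) (p. 7)] -/
theorem restrictCycle_mem_fullCycles (c : Perm κ) (hc : c.IsCycleOn (B : Set κ)) :
    restrictCycle c hc ∈ fullCycles B :=
  mem_fullCycles.2 fun a b => (hc.2 a.2 b.2).subtypePerm

/-- For an ambient cycle `c` on `B`, "`σ ∈ S^c`" reads "`σ x = c x` for all `x ∈ B`".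
[cite: LiebSahi2021, Prop. 3.4 (p. 7)] -/
theorem mem_permsContaining_restrict {c : Perm κ} (hc : c.IsCycleOn (B : Set κ)) {σ : Perm κ} :
    σ ∈ permsContaining B (restrictCycle c hc) ↔ ∀ x ∈ B, σ x = c x := by
  rw [mem_permsContaining]
  exact ⟨fun h x hx => h ⟨x, hx⟩, fun h x => h x x.2⟩

/-- **`S^c = {c · τ : τ ∈ Sym(J_c)}`**: the permutations containing the cycle are exactly the glued ones.
[cite: LiebSahi2021, Prop. 3.4, proof (p. 7)] -/
theorem permsContaining_eq_image (cB : Perm {x // x ∈ B}) :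
    permsContaining B cB = univ.image (glue B cB) := by
  ext σ
  rw [mem_permsContaining, mem_image]
  constructor
  · intro h
    -- `σ` maps `B` onto `B` (it is the bijection `cB` there), hence stabilises the complement
    have hσ : ∀ x, σ x ∉ B ↔ x ∉ B := by
      intro x
      by_cases hx : x ∈ B
      · have h1 : σ x ∈ B := by rw [h ⟨x, hx⟩]; exact (cB ⟨x, hx⟩).2
        exact ⟨fun h2 => absurd h1 h2, fun h2 => absurd hx h2⟩
      · refine ⟨fun _ => hx, fun _ hσx => ?_⟩
        obtain ⟨y, hy⟩ := cB.surjective ⟨σ x, hσx⟩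
        have h3 : σ y = σ x := by rw [h y, hy]
        exact hx (σ.injective h3 ▸ y.2)
    refine ⟨σ.subtypePerm hσ, mem_univ _, ?_⟩
    ext x
    by_cases hx : x ∈ B
    · rw [glue_apply_mem _ _ hx, ← h ⟨x, hx⟩]
    · rw [glue_apply_not_mem _ _ hx, subtypePerm_apply]
  · rintro ⟨τ, -, rfl⟩ x
    rw [← Subtype.coe_eta x x.2, glue_apply_mem _ _ x.2]

/-- **The core of the proof of Prop. 3.4, summed over `τ`**:
`Σ_τ (−1)^{C_{c·τ} − 1} E_{c·τ}(f) = E(Π_{i∈B} f^i) · Σ_τ (−1)^{C_τ} E_τ(f|_{Bᶜ})`.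
[cite: LiebSahi2021, Prop. 3.4, proof (p. 7)] -/
theorem sum_glue (μ : α → ℝ) (f : κ → α → ℝ) {cB : Perm {x // x ∈ B}} (hcB : ∀ a b, SameCycle cB a b)
    (hB : B.Nonempty) :
    ∑ τ : Perm {x // x ∉ B}, (-1 : ℝ) ^ ((orbits (glue B cB τ)).card - 1) * cycleE μ f (glue B cB τ) =
      ex μ (fun x => ∏ i ∈ B, f i x) * coRest μ f B := by
  unfold coRest
  rw [mul_sum]
  refine sum_congr rfl fun τ _ => ?_
  rw [card_orbits_glue hcB τ hB, Nat.add_sub_cancel, cycleE_glue μ f hcB τ hB]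
  ring

/-- `p = n`: the complementary factor of the full index set is `1` (the empty permutation: no cycles, empty
product). [cite: LiebSahi2021, Prop. 3.4 (p. 7, case `p = n`)] -/
theorem coRest_univ (μ : α → ℝ) (f : κ → α → ℝ) : coRest μ f (univ : Finset κ) = 1 := by
  unfold coRest
  haveI : IsEmpty {x // x ∉ (univ : Finset κ)} := ⟨fun x => x.2 (mem_univ _)⟩
  have h0 : ∀ σ : Perm {x // x ∉ (univ : Finset κ)}, orbits σ = ∅ := fun σ => by
    simp [orbits]
  rw [Fintype.sum_unique]
  simp [cycleE, h0]

/-- `p < n`: the complementary factor is `−E_{n−p}` of the complementary family (in cycle form over the index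
type `Bᶜ`). [cite: LiebSahi2021, Prop. 3.4 (p. 7, case `p < n`)] -/
theorem coRest_of_ne_univ (μ : α → ℝ) (f : κ → α → ℝ) (hB : B ≠ univ) :
    coRest μ f B = -cycleSum μ (fun j : {x // x ∉ B} => f j) := by
  unfold coRest cycleSum
  rw [← sum_neg_distrib]
  refine sum_congr rfl fun τ _ => ?_
  obtain ⟨y, hy⟩ : ∃ y, y ∉ B := not_forall.1 (mt eq_univ_iff_forall.2 hB)
  have hpos : 0 < (orbits τ).card := card_pos.2 ⟨_, orbit_mem_orbits τ ⟨y, hy⟩⟩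
  obtain ⟨m, hm⟩ : ∃ m, (orbits τ).card = m + 1 := ⟨_, (Nat.succ_pred_eq_of_pos hpos).symm⟩
  rw [hm, Nat.add_sub_cancel, pow_succ]
  ring

/-- **Lieb–Sahi's Proposition 3.4** (both cases at once): for a cycle `c` with nonempty support `B`,
`P_c = E(Π_{i∈B} f^i) · coRest μ f B`. [cite: LiebSahi2021, Prop. 3.4 (p. 7)] -/
theorem partialSum_eq (μ : α → ℝ) (f : κ → α → ℝ) {cB : Perm {x // x ∈ B}} (hcB : cB ∈ fullCycles B)
    (hB : B.Nonempty) : partialSum μ f B cB = ex μ (fun x => ∏ i ∈ B, f i x) * coRest μ f B := by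
  unfold partialSum
  rw [permsContaining_eq_image cB, sum_image fun τ₁ _ τ₂ _ h => glue_injective cB h]
  exact sum_glue μ f (mem_fullCycles.1 hcB) hB

/-- **Proposition 3.4, case `p < n`**: `P_c = −E(f^{i_1}⋯f^{i_p}) · E_{n−p}(f^{j_1}, f^{j_2}, …)`, the second
factor being Definition 3.1 of the complementary family `(f^j)_{j ∉ B}`.
[cite: LiebSahi2021, Prop. 3.4 (p. 7)] -/
theorem partialSum_eq_of_ne_univ (μ : α → ℝ) (f : κ → α → ℝ) {cB : Perm {x // x ∈ B}}
    (hcB : cB ∈ fullCycles B) (hB : B.Nonempty) (hBu : B ≠ univ) :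
    partialSum μ f B cB = -(ex μ (fun x => ∏ i ∈ B, f i x) * cycleSum μ (fun j : {x // x ∉ B} => f j)) := by
  rw [partialSum_eq μ f hcB hB, coRest_of_ne_univ μ f hBu]
  ring

/-- **Proposition 3.4, case `p = n`**: if the cycle is an `n`-cycle then `S^c = {c}` and `P_c = E(f^1⋯f^n)`.
[cite: LiebSahi2021, Prop. 3.4 (p. 7)] -/
theorem partialSum_univ (μ : α → ℝ) (f : κ → α → ℝ) [Nonempty κ] {cB : Perm {x // x ∈ (univ : Finset κ)}}
    (hcB : cB ∈ fullCycles univ) : partialSum μ f univ cB = ex μ (fun x => ∏ i, f i x) := by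
  rw [partialSum_eq μ f hcB univ_nonempty, coRest_univ, mul_one]

end Glue

end CycleSum

/-! ### The number of cycles with a given support -/

section Count

variable {κ : Type*} [Fintype κ] [DecidableEq κ]

/-- A permutation of a finite type with at least two elements is one cycle on everything iff its cycle type is
`{n}`, `n` the cardinality. [folklore] -/
private theorem forall_sameCycle_iff_cycleType {β : Type*} [Fintype β] [DecidableEq β] (h2 : 2 ≤ Fintype.card β)
    (g : Perm β) : (∀ a b, SameCycle g a b) ↔ g.cycleType = {Fintype.card β} := by
  haveI : Nontrivial β := Fintype.one_lt_card_iff_nontrivial.1 h2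
  constructor
  · intro hg
    have hne : ∀ x, g x ≠ x := by
      intro x hx
      obtain ⟨y, hy⟩ := exists_ne x
      obtain ⟨k, hk⟩ := hg x y
      exact hy ((zpow_apply_eq_self_of_apply_eq_self hx k).symm.trans hk).symm
    obtain ⟨x₀⟩ := (inferInstance : Nonempty β)
    have hcyc : g.IsCycle := ⟨x₀, hne x₀, fun y _ => hg x₀ y⟩
    have hsupp : g.support = univ := eq_univ_iff_forall.2 fun x => mem_support.2 (hne x)
    rw [hcyc.cycleType, hsupp, card_univ]
  · intro hg
    have hcyc : g.IsCycle := card_cycleType_eq_one.1 (by rw [hg]; rfl)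
    have hsupp : g.support = univ := by
      apply eq_univ_of_card
      rw [← sum_cycleType, hg, Multiset.sum_singleton]
    have hne : ∀ x, g x ≠ x := fun x => mem_support.1 (hsupp ▸ mem_univ x)
    obtain ⟨x, -, hx⟩ := hcyc
    exact fun a b => (hx (hne a)).symm.trans (hx (hne b))

/-- **There are `(|B| − 1)!` cycles with support `B`** (`B` nonempty; for `|B| = 1` the single one-cycle).
[cite: LiebSahi2021, §3.1 (p. 7: "each set partition … is the cycle partition of `Π (λ_i − 1)!` permutations", via Sahi2008 (6))] -/
theorem card_fullCycles (B : Finset κ) (hB : B.Nonempty) :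
    (CycleForm.fullCycles B).card = (B.card - 1).factorial := by
  have hcard : Fintype.card {x // x ∈ B} = B.card := Fintype.card_coe B
  rcases Nat.lt_or_ge B.card 2 with hlt | hge
  · -- `|B| = 1`: every permutation of the one-point type is a cycle on it, and there is exactly one
    have h1 : B.card = 1 := le_antisymm (by omega) hB.card_pos
    haveI : Subsingleton {x // x ∈ B} := Fintype.card_le_one_iff_subsingleton.1 (by rw [hcard, h1])
    have hall : CycleForm.fullCycles B = univ :=
      eq_univ_iff_forall.2 fun c => CycleForm.mem_fullCycles.2 fun a b => (Subsingleton.elim a b).sameCycle c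
    rw [hall, card_univ, Fintype.card_perm, hcard, h1]
    rfl
  · have h2 : 2 ≤ Fintype.card {x // x ∈ B} := by rw [hcard]; exact hge
    have hset : CycleForm.fullCycles B =
        (univ.filter fun g : Perm {x // x ∈ B} => g.cycleType = {Fintype.card {x // x ∈ B}}) := by
      ext g
      rw [CycleForm.mem_fullCycles, mem_filter, forall_sameCycle_iff_cycleType h2]
      simp
    rw [hset, Equiv.Perm.card_of_cycleType_singleton h2 le_rfl, Nat.choose_self, mul_one, hcard]

end Count

/-! ### `E_n = Σ_{c ∈ C(i)} P_c` and the block expansion along the cycle through a fixed index (p. 8) -/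

section Blocks

variable {κ : Type*} [Fintype κ] [DecidableEq κ]

/-- **The permutations whose cycle through `i` is `B` are exactly the glued `c·τ`, `c` a cycle on `B`.**
[cite: LiebSahi2021, p. 8 (proof of Thm. 3.5: "`E_n = Σ_{c ∈ C(i)} P_c`")] -/
theorem filter_orbit_eq_image (i : κ) {B : Finset κ} (hi : i ∈ B) :
    (univ.filter fun σ : Perm κ => orbit σ i = B) =
      ((fullCycles B) ×ˢ (univ : Finset (Perm {x // x ∉ B}))).image fun p => glue B p.1 p.2 := by
  ext σ
  simp only [mem_filter, mem_univ, true_and, mem_image, mem_product, and_true, Prod.exists,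
    mem_fullCycles]
  constructor
  · intro hσ
    have hstab : ∀ x, σ x ∈ B ↔ x ∈ B := by
      intro x
      rw [← hσ, mem_orbit, mem_orbit, sameCycle_apply_right]
    have hstab' : ∀ x, σ x ∉ B ↔ x ∉ B := fun x => not_congr (hstab x)
    refine ⟨σ.subtypePerm hstab, σ.subtypePerm hstab', ?_, ?_⟩
    · intro a b
      apply SameCycle.subtypePerm
      have ha : (a : κ) ∈ orbit σ i := by rw [hσ]; exact a.2
      have hb : (b : κ) ∈ orbit σ i := by rw [hσ]; exact b.2
      exact (mem_orbit.1 ha).symm.trans (mem_orbit.1 hb)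
    · ext x
      by_cases hx : x ∈ B
      · rw [glue_apply_mem _ _ hx, subtypePerm_apply]
      · rw [glue_apply_not_mem _ _ hx, subtypePerm_apply]
  · rintro ⟨cB, τ, hcB, rfl⟩
    exact orbit_glue_of_mem hcB τ hi

/-- The sum over `{σ : cycle of σ through i = B}` is the sum of the `P_c` over the cycles `c` with support `B`.
[cite: LiebSahi2021, p. 8 (proof of Thm. 3.5)] -/
theorem sum_filter_orbit_eq_sum_partialSum (μ : α → ℝ) (f : κ → α → ℝ) (i : κ) {B : Finset κ} (hi : i ∈ B) :
    ∑ σ ∈ univ.filter (fun σ : Perm κ => orbit σ i = B), (-1 : ℝ) ^ ((orbits σ).card - 1) * cycleE μ f σ =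
      ∑ cB ∈ fullCycles B, partialSum μ f B cB := by
  rw [filter_orbit_eq_image i hi, sum_image, sum_product]
  · refine sum_congr rfl fun cB _ => ?_
    unfold partialSum
    rw [permsContaining_eq_image cB, sum_image fun τ₁ _ τ₂ _ h => glue_injective cB h]
  · rintro ⟨cB, τ⟩ _ ⟨cB', τ'⟩ _ h
    exact Prod.ext_iff.2 (glue_inj.1 h)

/-- **`C(i)`, "the set of all cycles containing `i`"**, as pairs (support `B ∋ i`, cyclic permutation of `B`).
[cite: LiebSahi2021, p. 8 (proof of Thm. 3.5)] -/
def cyclesThrough (i : κ) : Finset (Σ B : Finset κ, Perm {x // x ∈ B}) :=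
  (univ.filter fun B : Finset κ => i ∈ B).sigma fun B => fullCycles B

/-- **`E_n(f^1,…,f^n) = Σ_{c ∈ C(i)} P_c`** — the cycles through a fixed index `i` partition `S_n`.
[cite: LiebSahi2021, p. 8 (proof of Thm. 3.5)] -/
theorem cycleSum_eq_sum_cyclesThrough (μ : α → ℝ) (f : κ → α → ℝ) (i : κ) :
    cycleSum μ f = ∑ c ∈ cyclesThrough i, partialSum μ f c.1 c.2 := by
  unfold cycleSum cyclesThrough
  rw [sum_sigma, ← sum_fiberwise_of_maps_to (s := (univ : Finset (Perm κ))) (t := univ.filter fun B => i ∈ B)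
    (g := fun σ : Perm κ => orbit σ i) fun σ _ => mem_filter.2 ⟨mem_univ _, self_mem_orbit σ i⟩]
  exact sum_congr rfl fun B hB => sum_filter_orbit_eq_sum_partialSum μ f i (mem_filter.1 hB).2

/-- **The block expansion of `E_n` along the cycle through a fixed index `i`** (Prop. 3.4 summed over `C(i)`):
`E(f) = Σ_{B ∋ i} (|B| − 1)! · E(Π_{j∈B} f^j) · coRest μ f B`, with `coRest μ f B = 1` if `B` is the whole
index set and `= −E_{n−|B|}(f|_{Bᶜ})` otherwise. [cite: LiebSahi2021, Prop. 3.4 and p. 8 (proof of Thm. 3.5)] -/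
theorem cycleSum_eq_sum_blocks (μ : α → ℝ) (f : κ → α → ℝ) (i : κ) :
    cycleSum μ f = ∑ B ∈ univ.filter (fun B : Finset κ => i ∈ B),
      ((B.card - 1).factorial : ℝ) * (ex μ (fun x => ∏ j ∈ B, f j x) * coRest μ f B) := by
  rw [cycleSum_eq_sum_cyclesThrough μ f i]
  unfold cyclesThrough
  rw [sum_sigma]
  refine sum_congr rfl fun B hB => ?_
  have hi : i ∈ B := (mem_filter.1 hB).2
  rw [sum_congr rfl fun cB hcB => partialSum_eq μ f hcB ⟨i, hi⟩, sum_const, nsmul_eq_mul,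
    card_fullCycles B ⟨i, hi⟩]

/-- The block expansion for the tree's `E_n` on `Fin n`. [cite: LiebSahi2021, Prop. 3.4 and p. 8 (proof of Thm. 3.5)] -/
theorem sahiE_eq_sum_blocks (μ : α → ℝ) {n : ℕ} (hn : 1 ≤ n) (f : Fin n → α → ℝ) (i : Fin n) :
    sahiE μ n f = ∑ B ∈ univ.filter (fun B : Finset (Fin n) => i ∈ B),
      ((B.card - 1).factorial : ℝ) * (ex μ (fun x => ∏ j ∈ B, f j x) * coRest μ f B) := by
  rw [sahiE_eq_cycleSum μ hn, cycleSum_eq_sum_blocks μ f i]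

end Blocks

end CycleForm

/-! ### Proposition 3.4 verbatim on `{1,…,n}` with an enumeration of `J_c` -/

open CycleForm

/-- **Lieb–Sahi 2022, Proposition 3.4 (`p < n`), verbatim.**  Let `c` be a cycle of `{0,…,n−1}` with support
`B = {i_1,…,i_p} ≠` everything (given as an ambient permutation with Mathlib's `IsCycleOn`), and let
`j : Fin m ≃ J_c` be any enumeration of the complement.  Then
`P_c = Σ_{σ ∈ S^c} (−1)^{C_σ−1} E_σ(f) = −E(f^{i_1}⋯f^{i_p}) · E_{n−p}(f^{j_1}, f^{j_2}, …)`,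
`E_{n−p}` the tree's `sahiE`. [cite: LiebSahi2021, Prop. 3.4 (p. 7)] -/
theorem liebSahi_prop34 (μ : α → ℝ) {n : ℕ} (f : Fin n → α → ℝ) {c : Perm (Fin n)} {B : Finset (Fin n)}
    (hc : c.IsCycleOn (B : Set (Fin n))) (hB : B.Nonempty) (hBu : B ≠ univ) {m : ℕ}
    (j : Fin m ≃ {x // x ∉ B}) :
    ∑ σ ∈ univ.filter (fun σ : Perm (Fin n) => ∀ x ∈ B, σ x = c x),
        (-1 : ℝ) ^ ((orbits σ).card - 1) * cycleE μ f σ =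
      -(ex μ (fun x => ∏ i ∈ B, f i x) * sahiE μ m (fun k => f (j k))) := by
  have hm : 1 ≤ m := by
    obtain ⟨y, hy⟩ : ∃ y, y ∉ B := not_forall.1 (mt eq_univ_iff_forall.2 hBu)
    have h1 : 0 < Fintype.card (Fin m) := Fintype.card_pos_iff.2 ⟨j.symm ⟨y, hy⟩⟩
    rw [Fintype.card_fin] at h1
    omega
  have hS : (univ.filter fun σ : Perm (Fin n) => ∀ x ∈ B, σ x = c x) =
      permsContaining B (restrictCycle c hc) := by
    ext σ
    rw [mem_filter, mem_permsContaining_restrict hc]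
    simp
  rw [hS, ← CycleForm.partialSum, partialSum_eq_of_ne_univ μ f (restrictCycle_mem_fullCycles c hc) hB hBu,
    sahiE_eq_cycleSum μ hm, cycleSum_comp_equiv μ j (fun y : {x // x ∉ B} => f y)]

/-- **Lieb–Sahi 2022, Proposition 3.4 (`p = n`), verbatim**: for an `n`-cycle `c`, `S^c = {c}` and
`P_c = E(f^1⋯f^n)`. [cite: LiebSahi2021, Prop. 3.4 (p. 7)] -/
theorem liebSahi_prop34_top (μ : α → ℝ) {n : ℕ} (hn : 1 ≤ n) (f : Fin n → α → ℝ) {c : Perm (Fin n)}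
    (hc : c.IsCycleOn ((univ : Finset (Fin n)) : Set (Fin n))) :
    ∑ σ ∈ univ.filter (fun σ : Perm (Fin n) => ∀ x ∈ (univ : Finset (Fin n)), σ x = c x),
        (-1 : ℝ) ^ ((orbits σ).card - 1) * cycleE μ f σ = ex μ (fun x => ∏ i, f i x) := by
  haveI : Nonempty (Fin n) := ⟨⟨0, hn⟩⟩
  have hS : (univ.filter fun σ : Perm (Fin n) => ∀ x ∈ (univ : Finset (Fin n)), σ x = c x) =
      permsContaining univ (restrictCycle c hc) := by
    ext σ
    rw [mem_filter, mem_permsContaining_restrict hc]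
    simp
  rw [hS, ← CycleForm.partialSum, partialSum_univ μ f (restrictCycle_mem_fullCycles c hc)]

end Literature.Combinatorics.Sahi2008
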